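import Literature.AlgebraicGeometry.Motives.MotivatedAut
import Literature.AlgebraicGeometry.Motives.Comparison
import HarnessLib

/-!
# Points of André's motivated Galois group over an extension, and André 1996, Thm. 0.4 / §4.6 (i)–(ii)

Y. André, *Pour une théorie inconditionnelle des motifs*, Publ. Math. IHÉS 83 (1996) (held:
paper:doi-10-1007-bf02698643): **Théorème 0.4** (p. 8): "La ⊗-catégorie `𝓜(𝒱)` [des motifs modelés
sur `𝒱`, découpés par les correspondances motivées] est tannakienne sur `ℚ_𝒱`, graduée, semi-simple,
polarisée. En outre, toute cohomologie classique `H*` se factorise à travers la cohomologie motivique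
`h` en donnant naissance à un foncteur fibre gradué sur `𝓜(𝒱)` (appelé `H`-réalisation)." — and its
standard group-theoretic consequences, **§4.6** (p. 24), for `K ↪ ℂ`, the Betti realisation `H_B` and
`G_𝒱 = Aut^⊗(H_B | 𝓜(𝒱))` (a pro-algebraic `ℚ`-group with central `w : 𝔾_m → G_𝒱`): for every
motive `M`, `G(M)` := the image of `G_𝒱` in `GL(H_B(M))` satisfies
"(i) `G(M)` est proréductif (du fait que `𝓜(𝒱)` est semi-simple);
 (ii) `G(M)` est le sous-groupe algébrique de `GL(H_B(M))` qui fixe les cycles motivés parmi les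
 tenseurs mixtes sur `H_B(M)`; réciproquement, tout tenseur mixte sur `H_B(M)` fixé par `G(M)` est
 motivé."
Remarque (ii), p. 25: connectedness of these groups is not known.

The tree carries the group in **elementary `ℚ`-points form** — `WeilCohomology.motivatedAut W S`
(`MotivatedAut.lean`): families `g = (g_{Y,i} ∈ GL(Hⁱ(Y)))` natural, multiplicative and fixing the
motivated classes on the smooth projective members of `S`; for `S` product-closed its restriction to
`S` is the group `G¹_S(ℚ)` of `ℚ`-points of the kernel `G¹ = ker χ` of the Tate character (module
docstring of `MotivatedAut.lean`). Statement (ii) is about the **algebraic group**, i.e. about points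
over every extension — `ℚ`-points do not suffice (they need not be Zariski dense off the neutral
component, and `π₀` is unknown, Remarque (ii)) — so this file first extends the elementary form to
**`L`-points** for a field extension `L ⊇ K` of the coefficients (`WeilCohomology.motivatedAutOver`:
families of `L`-linear automorphisms of `L ⊗_K Hⁱ(Y)` natural for `f* ⊗ L`, multiplicative for the
`L`-bilinear cup product `cupBaseChange`, fixing `1 ⊗ x` for motivated `x`; `ℚ`-points embed by base
change, `baseChange_mem_motivatedAutOver`, proved), and then vendors (i) and (ii) as **predicates on
an abstract Betti–Hodge datum `B : BettiHodgeData k`** (hypothesis schemas, exactly as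
`MotivatedGaloisGroupCounts.lean` and `Barriers/HodgeConjecture/MotivatedClassesAbelianVarieties.lean`
treat André's theorems: the theorem in print is the predicate AT the classical realisation, which the
tree does not construct; no `_holds` is owed for an abstract `B`):

* `Andre1996_thm04_completelyReducible B` — **(i), `ℚ`-points shadow**: for every product-closed
  `S` and smooth projective `Y ∈ S`, every `ℚ`-subspace of `Hⁱ(Y)` stable under `B.motivatedAut S`
  has a stable complement. (At the classical `B`: the Zariski closure `H` of `G¹_S(ℚ)` in `G¹_S`
  contains `(G¹_S)⁰` — rational points of a connected reductive group over `ℚ` are dense, Borel 18.3 —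
  so `H` is reductive with `G¹_S` (a normal subgroup of the reductive `G_S`, (i)); in characteristic
  `0` reductive groups are linearly reductive, and `G¹_S(ℚ)`-stable subspaces are `H`-stable.)
* `Andre1996_thm04_invariantsMotivated B` — **(ii), over `ℂ`-points**: for every product-closed
  `S`, smooth projective `Y ∈ S` of dimension `m` and `x ∈ H²ᵖ(Y)`, if `1 ⊗ x ∈ ℂ ⊗ H²ᵖ(Y)` is
  fixed by every `g ∈ B.motivatedAutOver ℂ S` then `x ∈ A_mot^p(Y) = B.W.motivatedClasses m Y p`.
  (At the classical `B`: `ℂ`-points of `G¹_S` are Zariski dense and invariants commute with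
  `ℚ → ℂ`, so `x` is `G¹_S`-invariant, i.e. `g x = χ(g)^p x` for `g ∈ G_S` (`w(𝔾_m)` central of
  weight `2p` on `H²ᵖ`, `G_S = w(𝔾_m)·G¹_S`), i.e. `x ∈ Hom_{G_S}(ℚ(-p), H²ᵖ(Y)) =
  Hom_{𝓜(S)}(𝟙(-p), h(Y)) = A_mot^p(Y)` by (ii) and the Tannakian dictionary §4.2–4.4 — morphisms of
  `𝓜(S)` are the motivated correspondences, `ℚ(-1)` being cut out in `h²(Y)` by a hyperplane class.)
  The converse (motivated ⟹ fixed) holds by definition (`apply_one_tmul_of_mem_motivatedClasses`),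
  whence the iff `Andre1996_thm04_invariantsMotivated.mem_motivatedClasses_iff`.

NOT rendered: **Scolie 2.5** (p. 17: for `L/K` separable with `L` separably closed,
`A_mot(X_L) = A_mot(X_{K^sép})`, and `A_mot(X_K)` is the subspace of `Gal(K^sép/K)`-invariants, the
action factoring through a finite group) — it compares motivated classes over two base fields, while
`motivatedClasses` needs a `WeilCohomology` and the tree's base change `BettiHodgeData.comap σ` is only
a `PreWeilCohomology`; the grading / polarisation / CM-splitting parts of Thm. 0.4 and §4.6 (iii);
connectedness (unknown). Mathlib has no Tannakian categories or reductive groups (searched `Tannaka`,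
`reductive`, `motivic`): the algebraic-group structure itself is not formalised, only its points.

## References

* Y. André, Publ. Math. IHÉS 83 (1996) 5–49: Thm. 0.4 (p. 8); §2.5 Scolie (p. 17); §4.2–4.4;
  §4.6 Définition, (i)–(iii) (p. 24), Remarques (p. 25). [Andre1996Motifs]
* P. Deligne, *Hodge cycles on abelian varieties*, LNM 900 (1982), I §3, Prop. 3.1 (a reductive
  group is the stabiliser of its tensor invariants; Chevalley). [Deligne1982HodgeCycles]
* A. Borel, *Linear Algebraic Groups*, 2nd ed., Thm. 18.3 (density of rational points).
-/

universe u v w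

open CategoryTheory AlgebraicGeometry MonoidalCategory CartesianMonoidalCategory
open scoped TensorProduct

noncomputable section

namespace Literature.AlgebraicGeometry.Motives

namespace WeilCohomology

variable {k : Type u} [Field k] {K : Type v} [Field K] [CharZero K] (W : WeilCohomology k K)
  (L : Type w) [Field L] [Algebra K L]

/-! ## `L`-points: the three conditions after extension of scalars -/

section Conditions

/-- The family `g = (g_{Y,i} ∈ GL_L(L ⊗_K Hⁱ(Y)))` *is natural on `S` over `L`*: it commutes with
`f* ⊗ L` for morphisms between smooth projective members of `S` (the `L`-points of `Aut^⊗` of the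
base-changed fibre functor; André 1996 §4.6). [cite: Andre1996Motifs, §4.6 Définition (p. 24)] -/
def IsNaturalOver (S : Set (SchemeOver k))
    (g : ∀ (Y : SchemeOver k) (i : ℕ), (L ⊗[K] W.obj Y i) ≃ₗ[L] (L ⊗[K] W.obj Y i)) : Prop :=
  ∀ ⦃m : ℕ⦄ ⦃Y : SchemeOver k⦄, Y ∈ S → IsSmoothProjective m Y →
    ∀ ⦃m' : ℕ⦄ ⦃Y' : SchemeOver k⦄, Y' ∈ S → IsSmoothProjective m' Y' →
      ∀ (f : Y ⟶ Y') (i : ℕ) (x : L ⊗[K] W.obj Y' i),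
        g Y i ((W.pullback f i).baseChange L x) = (W.pullback f i).baseChange L (g Y' i x)

/-- The family `g` *is multiplicative on `S` over `L`*: `g (x ∪ y) = g x ∪ g y` for the `L`-bilinear
cup product `W.cupBaseChange L` on the smooth projective members of `S`. [cite: Andre1996Motifs, §4.6 Définition (p. 24)] -/
def IsMultiplicativeOver (S : Set (SchemeOver k))
    (g : ∀ (Y : SchemeOver k) (i : ℕ), (L ⊗[K] W.obj Y i) ≃ₗ[L] (L ⊗[K] W.obj Y i)) : Prop :=
  ∀ ⦃m : ℕ⦄ ⦃Y : SchemeOver k⦄, Y ∈ S → IsSmoothProjective m Y →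
    ∀ ⦃i j l : ℕ⦄ (h : i + j = l) (x : L ⊗[K] W.obj Y i) (y : L ⊗[K] W.obj Y j),
      g Y l (W.cupBaseChange L h x y) = W.cupBaseChange L h (g Y i x) (g Y j y)

/-- The family `g` *fixes the motivated classes on `S` over `L`*: `g (1 ⊗ x) = 1 ⊗ x` for every
motivated class `x ∈ A_mot^p(Y)`, `Y ∈ S` smooth projective (André 1996 §4.6 (ii): the group is cut
out in `GL(H_B)` by the motivated cycles). [cite: Andre1996Motifs, §4.6 (ii) (p. 24)] -/
def FixesMotivatedClassesOver (S : Set (SchemeOver k))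
    (g : ∀ (Y : SchemeOver k) (i : ℕ), (L ⊗[K] W.obj Y i) ≃ₗ[L] (L ⊗[K] W.obj Y i)) : Prop :=
  ∀ ⦃m : ℕ⦄ ⦃Y : SchemeOver k⦄, Y ∈ S → IsSmoothProjective m Y →
    ∀ (p : ℕ), ∀ x ∈ W.motivatedClasses m Y p, g Y (2 * p) (1 ⊗ₜ x) = 1 ⊗ₜ x

end Conditions

/-! ## The group of `L`-points -/

/-- **The `L`-points of the motivated Galois group over the family `S`, in elementary form**: the
subgroup of `∏_{Y,i} GL_L(L ⊗_K Hⁱ(Y))` of the families that are natural, multiplicative and fix the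
motivated classes on the smooth projective members of `S` (after extension of scalars from `K` to
`L`; restricted to a product-closed `S` these are the `L`-points of `G¹_S = ker χ ⊆ G_S`, cf.
`WeilCohomology.motivatedAut` for `L = K`). [cite: Andre1996Motifs, §4.6 Définition and (ii) (p. 24)] -/
def motivatedAutOver (S : Set (SchemeOver k)) :
    Subgroup (∀ (Y : SchemeOver k) (i : ℕ), (L ⊗[K] W.obj Y i) ≃ₗ[L] (L ⊗[K] W.obj Y i)) where
  carrier := {g | W.IsNaturalOver L S g ∧ W.IsMultiplicativeOver L S g ∧
    W.FixesMotivatedClassesOver L S g}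
  mul_mem' := by
    rintro g h ⟨hgn, hgc, hgf⟩ ⟨hhn, hhc, hhf⟩
    refine ⟨?_, ?_, ?_⟩
    · intro m Y hYS hY m' Y' hY'S hY' f i x
      simp only [Pi.mul_apply, LinearEquiv.mul_apply]
      rw [hhn hYS hY hY'S hY' f i x, hgn hYS hY hY'S hY' f i]
    · intro m Y hYS hY i j l hij x y
      simp only [Pi.mul_apply, LinearEquiv.mul_apply]
      rw [hhc hYS hY hij, hgc hYS hY hij]
    · intro m Y hYS hY p x hx
      simp only [Pi.mul_apply, LinearEquiv.mul_apply]
      rw [hhf hYS hY p x hx, hgf hYS hY p x hx]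
  one_mem' := by
    refine ⟨?_, ?_, ?_⟩
    · intro m Y hYS hY m' Y' hY'S hY' f i x
      simp only [Pi.one_apply, LinearEquiv.coe_one, id_eq]
    · intro m Y hYS hY i j l hij x y
      simp only [Pi.one_apply, LinearEquiv.coe_one, id_eq]
    · intro m Y hYS hY p x hx
      simp only [Pi.one_apply, LinearEquiv.coe_one, id_eq]
  inv_mem' := by
    rintro g ⟨hgn, hgc, hgf⟩
    refine ⟨?_, ?_, ?_⟩
    · intro m Y hYS hY m' Y' hY'S hY' f i x
      simp only [Pi.inv_apply, LinearEquiv.coe_inv]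
      rw [LinearEquiv.symm_apply_eq, hgn hYS hY hY'S hY' f i, LinearEquiv.apply_symm_apply]
    · intro m Y hYS hY i j l hij x y
      simp only [Pi.inv_apply, LinearEquiv.coe_inv]
      rw [LinearEquiv.symm_apply_eq, hgc hYS hY hij, LinearEquiv.apply_symm_apply,
        LinearEquiv.apply_symm_apply]
    · intro m Y hYS hY p x hx
      simp only [Pi.inv_apply, LinearEquiv.coe_inv]
      rw [LinearEquiv.symm_apply_eq]
      exact (hgf hYS hY p x hx).symm

variable {W L}
variable {S : Set (SchemeOver k)}

/-- Membership in `W.motivatedAutOver L S`, unfolded. [folklore] -/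
theorem mem_motivatedAutOver_iff
    {g : ∀ (Y : SchemeOver k) (i : ℕ), (L ⊗[K] W.obj Y i) ≃ₗ[L] (L ⊗[K] W.obj Y i)} :
    g ∈ W.motivatedAutOver L S ↔
      W.IsNaturalOver L S g ∧ W.IsMultiplicativeOver L S g ∧ W.FixesMotivatedClassesOver L S g :=
  Iff.rfl

/-- **`K`-points are `L`-points**: the base change `g ⊗ L` of a motivated automorphism
`g ∈ W.motivatedAut S` lies in `W.motivatedAutOver L S` (naturality and the fixing of motivated
classes pass to `L ⊗_K ·` on pure tensors; multiplicativity because both sides of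
`(g ⊗ L)(x ∪ y) = (g ⊗ L) x ∪ (g ⊗ L) y` are `L`-bilinear and agree on pure tensors). [folklore] -/
theorem baseChange_mem_motivatedAutOver (L : Type w) [Field L] [Algebra K L]
    {g : ∀ (Y : SchemeOver k) (i : ℕ), W.obj Y i ≃ₗ[K] W.obj Y i} (hg : g ∈ W.motivatedAut S) :
    (fun Y i => (g Y i).baseChange K L (W.obj Y i) (W.obj Y i)) ∈ W.motivatedAutOver L S := by
  obtain ⟨hn, hc, hf⟩ := hg
  refine ⟨?_, ?_, ?_⟩
  · intro m Y hYS hY m' Y' hY'S hY' f i x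
    induction x using TensorProduct.induction_on with
    | zero => simp
    | tmul a x =>
      simp only [LinearMap.baseChange_tmul, LinearEquiv.baseChange_tmul]
      rw [hn hYS hY hY'S hY' f i x]
    | add x y hx hy => simp only [map_add, hx, hy]
  · intro m Y hYS hY i j l hij x y
    induction x using TensorProduct.induction_on with
    | zero => simp
    | tmul a x =>
      induction y using TensorProduct.induction_on with
      | zero => simp
      | tmul b y =>
        simp only [PreWeilCohomology.cupBaseChange_tmul, LinearEquiv.baseChange_tmul]
        rw [hc hYS hY hij x y]
      | add y y' hy hy' => simp only [map_add, hy, hy']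
    | add x x' hx hx' => simp only [map_add, LinearMap.add_apply, hx, hx']
  · intro m Y hYS hY p x hx
    rw [LinearEquiv.baseChange_tmul, hf hYS hY p x hx]

/-- Motivated classes are fixed, after `1 ⊗ ·`, by every `L`-point (the definitional half of
André's (ii)). [cite: Andre1996Motifs, §4.6 (ii) (p. 24)] -/
theorem apply_one_tmul_of_mem_motivatedClasses
    {g : ∀ (Y : SchemeOver k) (i : ℕ), (L ⊗[K] W.obj Y i) ≃ₗ[L] (L ⊗[K] W.obj Y i)}
    (hg : g ∈ W.motivatedAutOver L S) {m : ℕ} {Y : SchemeOver k} (hYS : Y ∈ S)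
    (hY : IsSmoothProjective m Y) {p : ℕ} {x : W.obj Y (2 * p)} (hx : x ∈ W.motivatedClasses m Y p) :
    g Y (2 * p) (1 ⊗ₜ x) = 1 ⊗ₜ x :=
  hg.2.2 hYS hY p x hx

end WeilCohomology

/-! ## The Betti layer and André's (i)–(ii) as predicates -/

/-- The family `S` of `k`-schemes is closed under (cartesian) products (the route's standing
hypothesis `∀ Y ∈ S, ∀ Y' ∈ S, Y ⊗ Y' ∈ S`, verbatim). [folklore] -/
def IsProductClosedFamily {k : Type u} [Field k] (S : Set (SchemeOver k)) : Prop :=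
  ∀ Y ∈ S, ∀ Y' ∈ S, Y ⊗ Y' ∈ S

namespace BettiHodgeData

variable {k : Type} [Field k] [Algebra k ℂ]

-- The subject `(B : BettiHodgeData k)` is written on each definition below (not as a section
-- variable) so that André's (i)–(ii) are visibly *open* predicates on an abstract datum (hypothesis
-- schemas: no `_holds` is owed for an abstract `B`) and not closed named facts `def X : Prop := …`
-- (same convention as for `IsNaturalOn` & co. in `MotivatedAut.lean`). Elaborated signatures are
-- unchanged.

/-- The `ℂ`-points of André's motivated Galois group of the Betti layer over the family `S`, in
elementary form: `B.W.motivatedAutOver ℂ S`. [cite: Andre1996Motifs, §4.6 Définition (p. 24)] -/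
abbrev motivatedAutOver (B : BettiHodgeData k) (S : Set (SchemeOver k)) :
    Subgroup (∀ (Y : SchemeOver k) (i : ℕ), (ℂ ⊗[ℚ] B.W.obj Y i) ≃ₗ[ℂ] (ℂ ⊗[ℚ] B.W.obj Y i)) :=
  B.W.motivatedAutOver ℂ S

/-- **André 1996, Thm. 0.4 / §4.6 (i) (the motivated Galois group is (pro)reductive) — `ℚ`-points
shadow, as a predicate on a Betti–Hodge datum.** "(i) `G(M)` est proréductif (du fait que `𝓜(𝒱)`
est semi-simple)". Rendered: for every product-closed family `S`, every smooth projective `Y ∈ S` and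
every degree `i`, every `ℚ`-subspace `V ⊆ Hⁱ(Y)` stable under all `g ∈ B.motivatedAut S` has a
complement stable under all of them. At the classical Betti–Hodge realisation this follows from (i):
`B.motivatedAut S` restricted to `S` is `G¹_S(ℚ)`, whose Zariski closure contains the connected
reductive `(G¹_S)⁰` (density of rational points, Borel 18.3) and is therefore reductive, hence
linearly reductive (characteristic `0`), and `G¹_S(ℚ)`-stable subspaces are stable under the
closure. Hypothesis schema: no `_holds` for an abstract `B`. [cite: Andre1996Motifs, Thm. 0.4 (p. 8) and §4.6 (i) (p. 24)] -/
def Andre1996_thm04_completelyReducible (B : BettiHodgeData k) : Prop :=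
  ∀ (S : Set (SchemeOver k)), IsProductClosedFamily S →
    ∀ ⦃m : ℕ⦄ ⦃Y : SchemeOver k⦄, Y ∈ S → IsSmoothProjective m Y →
      ∀ (i : ℕ) (V : Submodule ℚ (B.W.obj Y i)),
        (∀ g ∈ B.motivatedAut S, V ≤ V.comap (g Y i : B.W.obj Y i →ₗ[ℚ] B.W.obj Y i)) →
          ∃ V' : Submodule ℚ (B.W.obj Y i),
            (∀ g ∈ B.motivatedAut S, V' ≤ V'.comap (g Y i : B.W.obj Y i →ₗ[ℚ] B.W.obj Y i)) ∧
              IsCompl V V'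

/-- **André 1996, Thm. 0.4 / §4.6 (ii) (motivated classes are exactly the invariants of the motivated
Galois group), over `ℂ`-points, as a predicate on a Betti–Hodge datum.** "(ii) `G(M)` est le
sous-groupe algébrique de `GL(H_B(M))` qui fixe les cycles motivés parmi les tenseurs mixtes sur
`H_B(M)`; réciproquement, tout tenseur mixte sur `H_B(M)` fixé par `G(M)` est motivé." Rendered (the
non-definitional half, on the Betti cohomology of the members of a product-closed family): for `S`
product-closed, `Y ∈ S` smooth projective of dimension `m`, `p : ℕ` and `x ∈ H²ᵖ(Y)`, if `1 ⊗ x` is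
fixed by every `ℂ`-point `g ∈ B.motivatedAutOver ℂ S` then `x` is motivated,
`x ∈ B.W.motivatedClasses m Y p`. At the classical realisation: `ℂ`-points of `G¹_S` are Zariski
dense and invariants commute with `ℚ → ℂ`, so `x` is `G¹_S`-invariant, i.e. `χᵖ`-semi-invariant
under `G_S = w(𝔾_m)·G¹_S`, i.e. an element of `Hom_{𝓜(S)}(𝟙(-p), h(Y)) = A_motᵖ(Y)` (Tannakian
dictionary §4.2–4.4 with (ii)). The definitional half is `apply_one_tmul_of_mem_motivatedClasses`.
Hypothesis schema: no `_holds` for an abstract `B`. [cite: Andre1996Motifs, Thm. 0.4 (p. 8) and §4.6 (ii) (p. 24)] -/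
def Andre1996_thm04_invariantsMotivated (B : BettiHodgeData k) : Prop :=
  ∀ (S : Set (SchemeOver k)), IsProductClosedFamily S →
    ∀ ⦃m : ℕ⦄ ⦃Y : SchemeOver k⦄, Y ∈ S → IsSmoothProjective m Y →
      ∀ (p : ℕ) (x : B.W.obj Y (2 * p)),
        (∀ g ∈ B.motivatedAutOver S, g Y (2 * p) (1 ⊗ₜ x) = 1 ⊗ₜ x) →
          x ∈ B.W.motivatedClasses m Y p

variable {B : BettiHodgeData k}

/-- **Motivated classes = invariants of the `ℂ`-points**, under André's (ii): for `S` product-closed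
and `Y ∈ S` smooth projective, `x ∈ A_motᵖ(Y)` iff `1 ⊗ x` is fixed by `B.motivatedAutOver ℂ S`.
[cite: Andre1996Motifs, §4.6 (ii) (p. 24)] -/
theorem Andre1996_thm04_invariantsMotivated.mem_motivatedClasses_iff
    (h : B.Andre1996_thm04_invariantsMotivated) {S : Set (SchemeOver k)} (hS : IsProductClosedFamily S)
    {m : ℕ} {Y : SchemeOver k} (hYS : Y ∈ S) (hY : IsSmoothProjective m Y) (p : ℕ)
    (x : B.W.obj Y (2 * p)) :
    x ∈ B.W.motivatedClasses m Y p ↔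
      ∀ g ∈ B.motivatedAutOver S, g Y (2 * p) (1 ⊗ₜ x) = 1 ⊗ₜ x :=
  ⟨fun hx _ hg => WeilCohomology.apply_one_tmul_of_mem_motivatedClasses hg hYS hY hx,
    h S hS hYS hY p x⟩

/-- Under André's (ii), a class whose `1 ⊗ x` is fixed by all `ℂ`-points is in particular fixed by
every `ℚ`-point `g ∈ B.motivatedAut S` (it is motivated). [cite: Andre1996Motifs, §4.6 (ii) (p. 24)] -/
theorem Andre1996_thm04_invariantsMotivated.apply_eq_self
    (h : B.Andre1996_thm04_invariantsMotivated) {S : Set (SchemeOver k)} (hS : IsProductClosedFamily S)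
    {m : ℕ} {Y : SchemeOver k} (hYS : Y ∈ S) (hY : IsSmoothProjective m Y) {p : ℕ}
    {x : B.W.obj Y (2 * p)} (hx : ∀ g ∈ B.motivatedAutOver S, g Y (2 * p) (1 ⊗ₜ x) = 1 ⊗ₜ x)
    {g : ∀ (Y : SchemeOver k) (i : ℕ), B.W.obj Y i ≃ₗ[ℚ] B.W.obj Y i} (hg : g ∈ B.motivatedAut S) :
    g Y (2 * p) x = x :=
  hg.2.2 hYS hY p x (h S hS hYS hY p x hx)

end BettiHodgeData

end Literature.AlgebraicGeometry.Motives

end
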